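import Summits.HubbardSuperconductivity.HubbardSuperconductivity.Theses.BcsKacWindow
import Summits.HubbardSuperconductivity.HubbardSuperconductivity.Theorems.BcsKacWindowCoherenceWindowLROYangSide
import Literature.MathematicalPhysics.QuantumLattice.SectorGroundProjContinuity
import Literature.MathematicalPhysics.QuantumLattice.ApproximateEigenvectorLemmas
import Literature.MathematicalPhysics.QuantumLattice.PairFieldYangCeiling
import Literature.MathematicalPhysics.QuantumLattice.LTQOProofs
import Literature.MathematicalPhysics.QuantumLattice.HubbardWave0LiebProofs

/-!
# Route `BcsKacWindow`, crux `CoherenceWindowLRO` — transfer of pair order to EVERY sector ground state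

Helper file for the crux item `stmt-HubbardSuperconductivity-1319` (`CoherenceWindowLRO`, rank 2 of
route `BcsKacWindow`), line `birth`. The crux quantifies over EVERY normalised ground state of the
sector `(N, S^z = 0)` of `hubbardTorus 2 L 1 U` on the window tori `s₀ ≤ Δ(U)·L ≤ s`; any
construction of a paired low-energy state (reduced BCS + number projection + finite-mode
Bogoliubov, behind a multiscale stage above the gap scale) produces instead an approximately
invariant LOW-ENERGY SUBSPACE `W` of the sector. This file closes, sorry-free and in the tree's
`dotProduct` vocabulary, the finite-dimensional step from the latter to the former (the
"Kato / Schrieffer–Wolff for every sector ground state" step named in the crux's informal text):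

* `leakage_le` — **leakage bound**: for Hermitian `A` and `ψ = w + q`, `w† q = 0`, if
  `Re⟨ψ,Aψ⟩ ≤ E‖ψ‖²`, `Re⟨w,Aw⟩ ≥ (E-θ)‖w‖²`, `Re⟨q,Aq⟩ ≥ (E+γ)‖q‖²` (`γ > 0`) and
  `|⟨q,Aw⟩| ≤ ε‖q‖‖w‖`, then `(γ/2)‖q‖² ≤ (2ε²/γ + θ)‖w‖²`;
* `re_quadForm_sub_le` — the parallelogram bound `Re⟨u-v,B(u-v)⟩ ≤ 2Re⟨u,Bu⟩ + 2Re⟨v,Bv⟩` for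
  positive semidefinite `B`;
* `re_quadForm_ge_of_lowEnergySubspace` — **order transfer, abstract form**: `W ≤ K ≤ ℂ^ι`,
  (inside) energy `≥ E-θ` on `W`, (gap) energy `≥ E+γ` on `K ∩ W^⊥`, (coupling) `≤ ε` between
  them, (order) `Re⟨w,Bw⟩ ≥ α‖w‖²` on `W`, (ceiling) `Re⟨q,Bq⟩ ≤ M‖q‖²` on `K ∩ W^⊥` ⟹ every unit
  `ψ ∈ K` with `Re⟨ψ,Aψ⟩ ≤ E` has `Re⟨ψ,Bψ⟩ ≥ α/2 - (α/2 + M)(4ε²/γ² + 2θ/γ)` (split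
  `ψ = P_W ψ + r` with the tree's `projMatrix`);
* `re_quadForm_ge_of_lowEnergySubspace_ground` — the case `E = minEnergyOn A K`, `θ = 0`: the
  bound `α/2 - (α/2 + M)·4ε²/γ²` for EVERY unit sector ground vector `A ψ = (minEnergyOn A K) ψ`
  (degenerate multiplets included — no uniqueness is used);
* `coherenceWindowLRO_of_lowEnergySubspaces` — **the crux from low-energy-subspace data on the
  window tori**: if, with the crux's constants and pins, every window torus carries a subspace
  `W ≤ szSector N 0` with a gap `γ` above the sector energy on its orthocomplement, coupling `ε`,
  `d`-wave pair order `Re⟨w, Δ_d†Δ_d w⟩ ≥ α‖w‖²` on `W` at the crux's rate `α ≥ 4c₀Δ(U)²L⁴`, and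
  `16ε² ≤ γ²`, `256L⁴ε² ≤ αγ²`, then `CoherenceWindowLRO` — the ceiling being Yang's bound
  `Re⟨q, Δ_d†Δ_d q⟩ ≤ 2N(2L²-N+2)‖q‖² ≤ 8L⁴‖q‖²` (`re_expect_pairField_dWave_conjTranspose_mul_le_yang`)
  and `L ≥ 3` being forced in the window by `window_side_eventually_large`.

Reading of the constants (not used in the proofs): on a window torus `L ≤ s/Δ(U)` the intended `W`
is the dressed number-projected `d_{x²-y²}` BCS sector vector with its nodal few-quasiparticle
band, the gap on `W^⊥` is the pair-momentum (Anderson–Bogoliubov) scale `γ ≍ Δ(U)/s`, the order is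
`α ≍ (N(0)Δ log(W/Δ))² L⁴`, so `256L⁴ε² ≤ αγ²` asks for an off-diagonal remainder
`ε = O(Δ(U)²/s)` — available for each fixed `s` at small `U`, which is exactly why the crux lets
`U₁` depend on `s` while `c₀` does not. Nothing here constructs `W`: the hypothesis of the last
theorem is the finite-volume, source-free output a weak-coupling construction below
`Literature.Barriers.HubbardSuperconductivity.WeakCouplingCeiling` would have to deliver
(cf. item `stmt-HubbardSuperconductivity-2010`), and is NOT claimed.

Sources: T. Kato, *Perturbation Theory for Linear Operators* (1966), II-§1.4, II-§5.1 (reduction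
to an approximately invariant subspace; here in an elementary variational form); C. N. Yang,
Rev. Mod. Phys. **34** (1962) 694, §3–§4 (the ceiling); H. Tasaki, *Physics and Mathematics of
Quantum Many-Body Systems* (2020) §2.2 (variational principle in a sector). Tree API used:
`minEnergyOn_mul_le_re_rayleigh`, `projMatrix_map_mulVec_mem`, `projMatrix_map_mulVec_of_mem`,
`projMatrix_isHermitian`, `eucNorm`, `star_dotProduct_mulVec_comm`,
`re_expect_pairField_dWave_conjTranspose_mul_le_yang`, `window_side_eventually_large`
(Theorems, p146328). Folklore finite-dimensional linear algebra otherwise; no definition and no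
named fact is introduced.
-/

set_option linter.dupNamespace false

namespace Summit.HubbardSuperconductivity.HubbardSuperconductivity.Theorems.BcsKacWindow

open Matrix Literature.MathematicalPhysics.QuantumLattice
open Literature.MathematicalPhysics.QuantumLattice.EigenvalueContinuation
open Summit.HubbardSuperconductivity.HubbardSuperconductivity.Theses.BcsKacWindow
open scoped ComplexOrder

section LinearAlgebra

variable {ι : Type*} [Fintype ι]

/-- For Hermitian `A`, `Re ⟨w, A q⟩ = Re ⟨q, A w⟩`. [folklore] -/
theorem re_star_dotProduct_mulVec_symm {A : Matrix ι ι ℂ} (hA : A.IsHermitian) (w q : ι → ℂ) :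
    (star w ⬝ᵥ A *ᵥ q).re = (star q ⬝ᵥ A *ᵥ w).re := by
  rw [star_dotProduct_mulVec_comm hA.eq, Complex.star_def, Complex.conj_re]

/-- Expansion of a Hermitian quadratic form on a sum:
`Re ⟨w+q, A(w+q)⟩ = Re ⟨w, A w⟩ + 2 Re ⟨q, A w⟩ + Re ⟨q, A q⟩`. [folklore] -/
theorem re_quadForm_add {A : Matrix ι ι ℂ} (hA : A.IsHermitian) (w q : ι → ℂ) :
    (star (w + q) ⬝ᵥ A *ᵥ (w + q)).re =
      (star w ⬝ᵥ A *ᵥ w).re + 2 * (star q ⬝ᵥ A *ᵥ w).re + (star q ⬝ᵥ A *ᵥ q).re := by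
  rw [mulVec_add, star_add, add_dotProduct, dotProduct_add, dotProduct_add]
  simp only [Complex.add_re]
  rw [re_star_dotProduct_mulVec_symm hA w q]
  ring

/-- Pythagoras for `dotProduct`-orthogonal coordinate vectors:
`‖w + q‖² = ‖w‖² + ‖q‖²` when `w† q = 0`. [folklore] -/
theorem re_star_dotProduct_add_self_of_orth {w q : ι → ℂ} (h : star w ⬝ᵥ q = 0) :
    (star (w + q) ⬝ᵥ (w + q)).re = (star w ⬝ᵥ w).re + (star q ⬝ᵥ q).re := by
  have h' : star q ⬝ᵥ w = 0 := by rw [star_dotProduct, h, star_zero]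
  rw [star_add, add_dotProduct, dotProduct_add, dotProduct_add, h, h']
  simp only [Complex.add_re, Complex.zero_re]
  ring

/-- **Leakage bound (the finite-dimensional Schrieffer–Wolff / Feshbach step).** Let `A` be
Hermitian and `ψ = w + q` with `w† q = 0`. If `ψ` has energy at most `E` (`Re⟨ψ,Aψ⟩ ≤ E‖ψ‖²`),
`w` has energy at least `E - θ`, `q` feels a gap `γ > 0` above `E` and the coupling is small,
`|⟨q, A w⟩| ≤ ε ‖q‖ ‖w‖`, then the weight outside is controlled by the weight inside:
`(γ/2) ‖q‖² ≤ (2ε²/γ + θ) ‖w‖²`. (Expand `⟨ψ,Aψ⟩`, then `2ε‖q‖‖w‖ ≤ (γ/2)‖q‖² + (2ε²/γ)‖w‖²`.)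
Kato, *Perturbation Theory for Linear Operators* (1966) II-§1.4; folklore in this form. [folklore] -/
theorem leakage_le {A : Matrix ι ι ℂ} (hA : A.IsHermitian) {w q : ι → ℂ} (horth : star w ⬝ᵥ q = 0)
    {E γ ε θ : ℝ} (hγ : 0 < γ)
    (hlow : (star (w + q) ⬝ᵥ A *ᵥ (w + q)).re ≤ E * (star (w + q) ⬝ᵥ (w + q)).re)
    (hw : (E - θ) * (star w ⬝ᵥ w).re ≤ (star w ⬝ᵥ A *ᵥ w).re)
    (hq : (E + γ) * (star q ⬝ᵥ q).re ≤ (star q ⬝ᵥ A *ᵥ q).re)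
    (hoff : ‖star q ⬝ᵥ A *ᵥ w‖ ≤ ε * (eucNorm q * eucNorm w)) :
    γ / 2 * (star q ⬝ᵥ q).re ≤ (2 * ε ^ 2 / γ + θ) * (star w ⬝ᵥ w).re := by
  rw [re_quadForm_add hA, re_star_dotProduct_add_self_of_orth horth] at hlow
  have hR : -(ε * (eucNorm q * eucNorm w)) ≤ (star q ⬝ᵥ A *ᵥ w).re :=
    le_trans (neg_le_neg hoff) (neg_le_of_abs_le (Complex.abs_re_le_norm _))
  have hQ : (star q ⬝ᵥ q).re = eucNorm q ^ 2 := (eucNorm_sq q).symm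
  have hW : (star w ⬝ᵥ w).re = eucNorm w ^ 2 := (eucNorm_sq w).symm
  -- AM-GM: `2 ε ‖q‖ ‖w‖ ≤ (γ/2) ‖q‖² + (2ε²/γ) ‖w‖²`
  have hamgm : 2 * (ε * (eucNorm q * eucNorm w)) ≤
      γ / 2 * eucNorm q ^ 2 + 2 * ε ^ 2 / γ * eucNorm w ^ 2 := by
    have hsq : 0 ≤ (γ * eucNorm q - 2 * ε * eucNorm w) ^ 2 / (2 * γ) := by positivity
    have hid : γ / 2 * eucNorm q ^ 2 + 2 * ε ^ 2 / γ * eucNorm w ^ 2 -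
        2 * (ε * (eucNorm q * eucNorm w)) = (γ * eucNorm q - 2 * ε * eucNorm w) ^ 2 / (2 * γ) := by
      field_simp
      ring
    linarith
  rw [hQ, hW] at hlow ⊢
  rw [hQ] at hq
  rw [hW] at hw
  nlinarith [hlow, hw, hq, hR, hamgm]

/-- **Parallelogram bound for a positive semidefinite form**: `Re⟨u - v, B(u - v)⟩ ≤
2 Re⟨u, B u⟩ + 2 Re⟨v, B v⟩` (since `⟨u-v,B(u-v)⟩ + ⟨u+v,B(u+v)⟩ = 2⟨u,Bu⟩ + 2⟨v,Bv⟩` and the second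
term is nonnegative). [folklore] -/
theorem re_quadForm_sub_le {B : Matrix ι ι ℂ} (hB : B.PosSemidef) (u v : ι → ℂ) :
    (star (u - v) ⬝ᵥ B *ᵥ (u - v)).re ≤ 2 * (star u ⬝ᵥ B *ᵥ u).re + 2 * (star v ⬝ᵥ B *ᵥ v).re := by
  have h1 := re_quadForm_add hB.1 u v
  have h2 := re_quadForm_add hB.1 u (-v)
  have hpos : 0 ≤ (star (u + v) ⬝ᵥ B *ᵥ (u + v)).re := by
    have := hB.re_dotProduct_nonneg (u + v)
    simpa using this
  simp only [mulVec_neg, star_neg, neg_dotProduct, dotProduct_neg, neg_neg, Complex.neg_re,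
    ← sub_eq_add_neg] at h2
  linarith

/-- **Order transfer to every low-energy vector of a sector (abstract form).** Let `A` be Hermitian,
`B` positive semidefinite, `W ≤ K` subspaces of `ℂ^ι` (`K` = the sector, `W` = a "low-energy
subspace"), and `E, γ > 0, ε ≥ 0, θ ≥ 0, α ≥ 0, M ≥ 0` reals such that
* (inside)  `Re⟨w, A w⟩ ≥ (E - θ)‖w‖²` for `w ∈ W`;
* (gap)     `Re⟨q, A q⟩ ≥ (E + γ)‖q‖²` for `q ∈ K ∩ W^⊥`;
* (coupling) `|⟨q, A w⟩| ≤ ε‖q‖‖w‖` for `q ∈ K ∩ W^⊥`, `w ∈ W`;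
* (order)   `Re⟨w, B w⟩ ≥ α‖w‖²` for `w ∈ W`;
* (ceiling) `Re⟨q, B q⟩ ≤ M‖q‖²` for `q ∈ K ∩ W^⊥`.
Then every unit vector `ψ ∈ K` of energy `Re⟨ψ, A ψ⟩ ≤ E` has
`Re⟨ψ, B ψ⟩ ≥ α/2 - (α/2 + M)(4ε²/γ² + 2θ/γ)`.
Proof: split `ψ = P_W ψ + r` (`projMatrix`); the leakage bound `leakage_le` gives
`‖r‖² ≤ (4ε²/γ² + 2θ/γ)‖P_W ψ‖²`, and the parallelogram bound `re_quadForm_sub_le` gives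
`α‖P_W ψ‖² ≤ Re⟨P_W ψ, B P_W ψ⟩ ≤ 2Re⟨ψ,Bψ⟩ + 2M‖r‖²`. Kato (1966) II-§1.4 (reduction to an
approximately invariant subspace); folklore in this finite-dimensional form. [folklore] -/
theorem re_quadForm_ge_of_lowEnergySubspace [DecidableEq ι] {A B : Matrix ι ι ℂ}
    (hA : A.IsHermitian) (hB : B.PosSemidef) {K W : Submodule ℂ (ι → ℂ)} (hWK : W ≤ K)
    {E γ ε θ α M : ℝ} (hγ : 0 < γ) (hθ : 0 ≤ θ) (hα : 0 ≤ α) (hM : 0 ≤ M)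
    (hw : ∀ w ∈ W, (E - θ) * (star w ⬝ᵥ w).re ≤ (star w ⬝ᵥ A *ᵥ w).re)
    (hq : ∀ q ∈ K, (∀ w ∈ W, star w ⬝ᵥ q = 0) →
      (E + γ) * (star q ⬝ᵥ q).re ≤ (star q ⬝ᵥ A *ᵥ q).re)
    (hoff : ∀ q ∈ K, (∀ w ∈ W, star w ⬝ᵥ q = 0) → ∀ w ∈ W,
      ‖star q ⬝ᵥ A *ᵥ w‖ ≤ ε * (eucNorm q * eucNorm w))
    (hord : ∀ w ∈ W, α * (star w ⬝ᵥ w).re ≤ (star w ⬝ᵥ B *ᵥ w).re)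
    (hceil : ∀ q ∈ K, (∀ w ∈ W, star w ⬝ᵥ q = 0) →
      (star q ⬝ᵥ B *ᵥ q).re ≤ M * (star q ⬝ᵥ q).re)
    {ψ : ι → ℂ} (hψK : ψ ∈ K) (hψ1 : star ψ ⬝ᵥ ψ = 1) (hlow : (star ψ ⬝ᵥ A *ᵥ ψ).re ≤ E) :
    α / 2 - (α / 2 + M) * (4 * ε ^ 2 / γ ^ 2 + 2 * θ / γ) ≤ (star ψ ⬝ᵥ B *ᵥ ψ).re := by
  classical
  -- the orthogonal splitting `ψ = p + r`, `p = P_W ψ ∈ W`, `r ∈ K ∩ W^⊥`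
  set P : Matrix ι ι ℂ := projMatrix (W.map
    ((WithLp.linearEquiv 2 ℂ (ι → ℂ)).symm : (ι → ℂ) →ₗ[ℂ] EuclideanSpace ℂ ι)) with hP_def
  have hPh : P.IsHermitian := projMatrix_isHermitian _
  set p : ι → ℂ := P *ᵥ ψ with hp_def
  set r : ι → ℂ := ψ - p with hr_def
  have hpW : p ∈ W := projMatrix_map_mulVec_mem W ψ
  have hpK : p ∈ K := hWK hpW
  have hrK : r ∈ K := K.sub_mem hψK hpK
  have hPφ : ∀ φ ∈ W, star φ ⬝ᵥ p = star φ ⬝ᵥ ψ := by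
    intro φ hφ
    have hfix : P *ᵥ φ = φ := projMatrix_map_mulVec_of_mem W hφ
    rw [hp_def]
    conv_rhs => rw [← hfix]
    rw [star_mulVec, hPh.eq, ← dotProduct_mulVec]
  have hrorth : ∀ φ ∈ W, star φ ⬝ᵥ r = 0 := by
    intro φ hφ
    rw [hr_def, dotProduct_sub, hPφ φ hφ, sub_self]
  have hpr : star p ⬝ᵥ r = 0 := hrorth p hpW
  have hψeq : ψ = p + r := by rw [hr_def, add_sub_cancel]
  -- leakage: `(γ/2)‖r‖² ≤ (2ε²/γ + θ)‖p‖²`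
  have hlow' : (star (p + r) ⬝ᵥ A *ᵥ (p + r)).re ≤ E * (star (p + r) ⬝ᵥ (p + r)).re := by
    rw [← hψeq, hψ1, Complex.one_re, mul_one]
    exact hlow
  have hleak := leakage_le hA hpr hγ hlow' (hw p hpW) (hq r hrK hrorth) (hoff r hrK hrorth p hpW)
  -- `‖p‖² + ‖r‖² = 1`
  have hsum : (star p ⬝ᵥ p).re + (star r ⬝ᵥ r).re = 1 := by
    rw [← re_star_dotProduct_add_self_of_orth hpr, ← hψeq, hψ1, Complex.one_re]
  have hp0 : 0 ≤ (star p ⬝ᵥ p).re := by rw [← eucNorm_sq]; positivity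
  have hr0 : 0 ≤ (star r ⬝ᵥ r).re := by rw [← eucNorm_sq]; positivity
  -- order on `p`, parallelogram, ceiling on `r`
  have hBp := hord p hpW
  have hpar : (star p ⬝ᵥ B *ᵥ p).re ≤
      2 * (star ψ ⬝ᵥ B *ᵥ ψ).re + 2 * (star r ⬝ᵥ B *ᵥ r).re := by
    have h := re_quadForm_sub_le hB ψ r
    have hpr' : ψ - r = p := by rw [hr_def, sub_sub_cancel]
    rwa [hpr'] at h
  have hBr := hceil r hrK hrorth
  -- arithmetic
  set Pn : ℝ := (star p ⬝ᵥ p).re with hPn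
  set R : ℝ := (star r ⬝ᵥ r).re with hR
  set κ : ℝ := 4 * ε ^ 2 / γ ^ 2 + 2 * θ / γ with hκ_def
  have hκ0 : 0 ≤ κ := by positivity
  have hRle : R ≤ κ * Pn := by
    have hκ : κ * Pn = (2 / γ) * ((2 * ε ^ 2 / γ + θ) * Pn) := by
      rw [hκ_def]
      field_simp
      ring
    have h2γ : (0 : ℝ) ≤ 2 / γ := by positivity
    calc R = (2 / γ) * (γ / 2 * R) := by field_simp
      _ ≤ (2 / γ) * ((2 * ε ^ 2 / γ + θ) * Pn) := mul_le_mul_of_nonneg_left hleak h2γ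
      _ = κ * Pn := hκ.symm
  have hRκ : R ≤ κ := by
    calc R ≤ κ * Pn := hRle
      _ ≤ κ * 1 := mul_le_mul_of_nonneg_left (by linarith) hκ0
      _ = κ := mul_one κ
  have hkey : α - (α + 2 * M) * R ≤ 2 * (star ψ ⬝ᵥ B *ᵥ ψ).re := by
    have h1 : α * Pn = α - α * R := by rw [show Pn = 1 - R by linarith]; ring
    nlinarith [hBp, hpar, hBr, h1]
  have hmono : (α + 2 * M) * R ≤ (α + 2 * M) * κ :=
    mul_le_mul_of_nonneg_left hRκ (by positivity)
  nlinarith [hkey, hmono]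

/-- **Order transfer to every sector ground state (abstract form).** The case `E = minEnergyOn A K`,
`θ = 0` of `re_quadForm_ge_of_lowEnergySubspace`: the (inside) hypothesis is the variational
principle, and a sector eigenvector `A ψ = (minEnergyOn A K) ψ` has energy exactly `E`. So: a gap
`γ` above the sector energy on `K ∩ W^⊥`, coupling `ε` between `W` and `K ∩ W^⊥`, order `α` on `W`
and ceiling `M` on `K ∩ W^⊥` give `Re⟨ψ, B ψ⟩ ≥ α/2 - (α/2 + M)·4ε²/γ²` for EVERY unit sector
ground vector `ψ` (degenerate or not). [folklore] -/
theorem re_quadForm_ge_of_lowEnergySubspace_ground [DecidableEq ι] {A B : Matrix ι ι ℂ}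
    (hA : A.IsHermitian) (hB : B.PosSemidef) {K W : Submodule ℂ (ι → ℂ)} (hWK : W ≤ K)
    {γ ε α M : ℝ} (hγ : 0 < γ) (hα : 0 ≤ α) (hM : 0 ≤ M)
    (hq : ∀ q ∈ K, (∀ w ∈ W, star w ⬝ᵥ q = 0) →
      (A.minEnergyOn K + γ) * (star q ⬝ᵥ q).re ≤ (star q ⬝ᵥ A *ᵥ q).re)
    (hoff : ∀ q ∈ K, (∀ w ∈ W, star w ⬝ᵥ q = 0) → ∀ w ∈ W,
      ‖star q ⬝ᵥ A *ᵥ w‖ ≤ ε * (eucNorm q * eucNorm w))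
    (hord : ∀ w ∈ W, α * (star w ⬝ᵥ w).re ≤ (star w ⬝ᵥ B *ᵥ w).re)
    (hceil : ∀ q ∈ K, (∀ w ∈ W, star w ⬝ᵥ q = 0) →
      (star q ⬝ᵥ B *ᵥ q).re ≤ M * (star q ⬝ᵥ q).re)
    {ψ : ι → ℂ} (hψK : ψ ∈ K) (hψ1 : star ψ ⬝ᵥ ψ = 1)
    (hψ : A *ᵥ ψ = ((A.minEnergyOn K : ℝ) : ℂ) • ψ) :
    α / 2 - (α / 2 + M) * (4 * ε ^ 2 / γ ^ 2) ≤ (star ψ ⬝ᵥ B *ᵥ ψ).re := by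
  have hw : ∀ w ∈ W, (A.minEnergyOn K - 0) * (star w ⬝ᵥ w).re ≤ (star w ⬝ᵥ A *ᵥ w).re := by
    intro w hw
    rw [sub_zero]
    exact minEnergyOn_mul_le_re_rayleigh hA K (hWK hw)
  have hlow : (star ψ ⬝ᵥ A *ᵥ ψ).re ≤ A.minEnergyOn K := by
    rw [hψ, dotProduct_smul, hψ1, smul_eq_mul, mul_one, Complex.ofReal_re]
  have h := re_quadForm_ge_of_lowEnergySubspace hA hB hWK hγ le_rfl hα hM hw hq hoff hord hceil
    hψK hψ1 hlow
  simpa only [mul_zero, zero_div, add_zero] using h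

end LinearAlgebra

/-! ### The crux from low-energy-subspace data on the window tori -/

/-- **`CoherenceWindowLRO` from low-energy-subspace data (the shape of the every-ground-state step
of line `birth`, closed in advance).** Suppose that with the crux's own constants and pins
(`[a,b] ⊂ (0,1/2)`, `e^{-κ₂/U²} ≤ Δ(U) ≤ e^{-κ₁/U²}`, `c₀, s₀ > 0`), for every window top `s ≥ s₀`
there is `U₁ > 0` such that for all `δ ∈ [a,b]`, `U ∈ (0,U₁)` and even `L` with `s₀ ≤ Δ(U)L ≤ s`
one is GIVEN, for `H = hubbardTorus 2 L 1 U`, the sector `K = szSector N 0` (`N = 2⌊(1-δ)L²/2⌋`,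
sector energy `e = minEnergyOn H K`) and `B = Δ_d† Δ_d`: a subspace `W ≤ K` and reals `γ > 0`,
`ε ≥ 0`, `α` with
* (gap) `Re⟨q, H q⟩ ≥ (e + γ)‖q‖²` on `K ∩ W^⊥`,
* (coupling) `|⟨q, H w⟩| ≤ ε‖q‖‖w‖` for `q ∈ K ∩ W^⊥`, `w ∈ W`,
* (order) `Re⟨w, Δ_d†Δ_d w⟩ ≥ α‖w‖²` on `W`, at the crux's rate `α ≥ 4c₀Δ(U)²L⁴`,
* (smallness) `16ε² ≤ γ²` and `256 L⁴ ε² ≤ α γ²`.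
Then `CoherenceWindowLRO` holds (same `a, b, κ₁, κ₂, c₀, s₀, Δ`; `U₁` shrunk so that `L ≥ 3` in the
window). The ceiling on `K ∩ W^⊥` is Yang's bound `Re⟨q, Δ_d†Δ_d q⟩ ≤ 2N(2L²-N+2)‖q‖² ≤ 8L⁴‖q‖²`
(`re_expect_pairField_dWave_conjTranspose_mul_le_yang`), so by
`re_quadForm_ge_of_lowEnergySubspace_ground` every unit sector ground state has
`Re⟨ψ, Δ_d†Δ_d ψ⟩ ≥ α/2 - α/8 - α/8 = α/4 ≥ c₀Δ(U)²L⁴`.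
In the intended use `W` is the dressed, number-projected `d_{x²-y²}` BCS sector vector together
with its nodal few-quasiparticle band, `γ ≍ Δ(U)/s` is the pair-momentum (Anderson–Bogoliubov) gap
on a torus of side `L ≤ s/Δ(U)`, and `ε = O(Δ(U)²/s)` is the precision a multiscale construction
below the gap scale must deliver — which is why the crux lets `U₁` depend on `s`. The hypothesis is
NOT claimed here; this theorem only discharges the finite-dimensional transfer. [folklore] -/
theorem coherenceWindowLRO_of_lowEnergySubspaces :
    (∃ (a b κ₁ κ₂ c₀ s₀ : ℝ) (Δ : ℝ → ℝ), 0 < a ∧ a < b ∧ b < 1 / 2 ∧ 0 < κ₁ ∧ κ₁ ≤ κ₂ ∧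
      0 < c₀ ∧ 0 < s₀ ∧
      (∀ U : ℝ, 0 < U → Real.exp (-(κ₂ / U ^ 2)) ≤ Δ U ∧ Δ U ≤ Real.exp (-(κ₁ / U ^ 2))) ∧
      ∀ s : ℝ, s₀ ≤ s → ∃ U₁ : ℝ, 0 < U₁ ∧ ∀ δ ∈ Set.Icc a b, ∀ U ∈ Set.Ioo (0 : ℝ) U₁,
        ∀ (L : ℕ) [NeZero L], Even L → s₀ ≤ Δ U * L → Δ U * L ≤ s →
          ∃ (W : Submodule ℂ (Fock (Orb (FermionTorus 2 L)))) (γ ε α : ℝ),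
            W ≤ szSector (2 * ⌊(1 - δ) * (L : ℝ) ^ 2 / 2⌋₊) 0 ∧ 0 < γ ∧ 0 ≤ ε ∧
            16 * ε ^ 2 ≤ γ ^ 2 ∧ 256 * (L : ℝ) ^ 4 * ε ^ 2 ≤ α * γ ^ 2 ∧
            4 * c₀ * Δ U ^ 2 * (L : ℝ) ^ 4 ≤ α ∧
            (∀ q ∈ szSector (2 * ⌊(1 - δ) * (L : ℝ) ^ 2 / 2⌋₊) 0, (∀ w ∈ W, star w ⬝ᵥ q = 0) →
              ((hubbardTorus 2 L 1 U).minEnergyOn (szSector (2 * ⌊(1 - δ) * (L : ℝ) ^ 2 / 2⌋₊) 0)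
                  + γ) * (star q ⬝ᵥ q).re ≤ (star q ⬝ᵥ hubbardTorus 2 L 1 U *ᵥ q).re) ∧
            (∀ q ∈ szSector (2 * ⌊(1 - δ) * (L : ℝ) ^ 2 / 2⌋₊) 0, (∀ w ∈ W, star w ⬝ᵥ q = 0) →
              ∀ w ∈ W, ‖star q ⬝ᵥ hubbardTorus 2 L 1 U *ᵥ w‖ ≤ ε * (eucNorm q * eucNorm w)) ∧
            (∀ w ∈ W, α * (star w ⬝ᵥ w).re ≤
              (star w ⬝ᵥ ((pairField dWaveFormFactor L)ᴴ * pairField dWaveFormFactor L) *ᵥ w).re)) →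
    CoherenceWindowLRO := by
  intro h
  obtain ⟨a, b, κ₁, κ₂, c₀, s₀, Δ, ha, hab, hb, hκ₁, hκ₁₂, hc₀, hs₀, hpin, hS⟩ := h
  refine ⟨a, b, κ₁, κ₂, c₀, s₀, Δ, ha, hab, hb, hκ₁, hκ₁₂, hc₀, hs₀, hpin, fun s hs => ?_⟩
  obtain ⟨U₁, hU₁, hwin⟩ := hS s hs
  clear hS
  -- shrink `U₁` so that the window forces `L ≥ 3`
  obtain ⟨U₂, hU₂, hside⟩ :=
    window_side_eventually_large hκ₁ hs₀ (fun U hU => (hpin U hU).2) (2 : ℝ)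
  refine ⟨min U₁ U₂, lt_min hU₁ hU₂, ?_⟩
  intro δ hδ U hU L _ hE hlo hhi ψ hψ1 hgs
  have hUpos : 0 < U := hU.1
  have hU₁' : U ∈ Set.Ioo (0 : ℝ) U₁ := ⟨hU.1, lt_of_lt_of_le hU.2 (min_le_left _ _)⟩
  have hL2 : (2 : ℝ) < L := hside U hUpos (lt_of_lt_of_le hU.2 (min_le_right _ _)) L hlo
  clear hside
  have hL3 : 3 ≤ L := by
    have : (2 : ℕ) < L := by exact_mod_cast hL2
    omega
  obtain ⟨W, γ, ε, α, hWK, hγ, hε, hεγ, hsmall, hαc, hgap, hoff, hord⟩ :=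
    hwin δ hδ U hU₁' L hE hlo hhi
  clear hwin
  have hHh : (hubbardTorus 2 L 1 U).IsHermitian :=
    hubbardTorus_isHermitian (hamiltonian_isHermitian_and_commute_holds _) 1 U
  have hBp : ((pairField dWaveFormFactor L)ᴴ * pairField dWaveFormFactor L).PosSemidef :=
    pairField_conjTranspose_mul_self_posSemidef dWaveFormFactor L
  obtain ⟨hψK, -, hHψ⟩ := hgs
  -- the particle number of the sector: even, at most `L²`
  have hNeven : Even (2 * ⌊(1 - δ) * (L : ℝ) ^ 2 / 2⌋₊) := even_two_mul _
  have h1δ : 0 ≤ 1 - δ := by linarith [hδ.2, hb]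
  have hδ0 : 0 ≤ δ := le_trans ha.le hδ.1
  have hLpos : (0 : ℝ) < (L : ℝ) := by linarith
  have hfl : (⌊(1 - δ) * (L : ℝ) ^ 2 / 2⌋₊ : ℝ) ≤ (1 - δ) * (L : ℝ) ^ 2 / 2 :=
    Nat.floor_le (by positivity)
  have hNle : ((2 * ⌊(1 - δ) * (L : ℝ) ^ 2 / 2⌋₊ : ℕ) : ℝ) ≤ (L : ℝ) ^ 2 := by
    push_cast
    nlinarith [sq_nonneg (L : ℝ)]
  have hN2 : 2 * ⌊(1 - δ) * (L : ℝ) ^ 2 / 2⌋₊ ≤ 2 * L ^ 2 := by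
    have h' : ((2 * ⌊(1 - δ) * (L : ℝ) ^ 2 / 2⌋₊ : ℕ) : ℝ) ≤ ((2 * L ^ 2 : ℕ) : ℝ) := by
      push_cast at hNle ⊢
      nlinarith [sq_nonneg (L : ℝ)]
    exact_mod_cast h'
  -- Yang's ceiling on the sector (hence on `K ∩ W^⊥`): `M = 2N(2L² - N + 2) ≤ 8L⁴`
  obtain ⟨Nr, hNr⟩ : ∃ Nr : ℝ, Nr = ((2 * ⌊(1 - δ) * (L : ℝ) ^ 2 / 2⌋₊ : ℕ) : ℝ) := ⟨_, rfl⟩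
  have hNr0 : 0 ≤ Nr := by rw [hNr]; exact Nat.cast_nonneg _
  have hNrle : Nr ≤ (L : ℝ) ^ 2 := by rw [hNr]; exact hNle
  have hM0 : 0 ≤ 2 * Nr * (2 * (L : ℝ) ^ 2 - Nr + 2) :=
    mul_nonneg (mul_nonneg two_pos.le hNr0) (by linarith)
  have hM8 : 2 * Nr * (2 * (L : ℝ) ^ 2 - Nr + 2) ≤ 8 * (L : ℝ) ^ 4 := by
    have hL1 : (1 : ℝ) ≤ (L : ℝ) ^ 2 := by nlinarith
    nlinarith
  have hceil : ∀ q ∈ szSector (2 * ⌊(1 - δ) * (L : ℝ) ^ 2 / 2⌋₊) 0, (∀ w ∈ W, star w ⬝ᵥ q = 0) →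
      (star q ⬝ᵥ ((pairField dWaveFormFactor L)ᴴ * pairField dWaveFormFactor L) *ᵥ q).re ≤
        (2 * Nr * (2 * (L : ℝ) ^ 2 - Nr + 2)) * (star q ⬝ᵥ q).re := by
    intro q hq _
    have hqN : IsNParticle (2 * ⌊(1 - δ) * (L : ℝ) ^ 2 / 2⌋₊) q := ((mem_szSector_iff _ 0 q).1 hq).1
    have hy := re_expect_pairField_dWave_conjTranspose_mul_le_yang L hL3 hNeven hN2 hqN
    simp only [expect] at hy
    rw [hNr]
    exact hy
  -- positivity of the order constant
  have hΔpos : 0 < Δ U := lt_of_lt_of_le (Real.exp_pos _) (hpin U hUpos).1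
  have hα0 : 0 ≤ α := le_trans (by positivity) hαc
  -- the abstract transfer at the ground state `ψ`
  have hmain := re_quadForm_ge_of_lowEnergySubspace_ground hHh hBp hWK hγ hα0 hM0 hgap hoff hord
    hceil hψK hψ1 hHψ
  -- arithmetic: `(α/2)(4ε²/γ²) ≤ α/8` and `M (4ε²/γ²) ≤ α/8`
  have hγ2 : 0 < γ ^ 2 := by positivity
  have h1 : α / 2 * (4 * ε ^ 2 / γ ^ 2) ≤ α / 8 := by
    rw [show α / 2 * (4 * ε ^ 2 / γ ^ 2) = (2 * α * ε ^ 2) / γ ^ 2 by ring, div_le_iff₀ hγ2]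
    linarith [mul_le_mul_of_nonneg_left hεγ hα0]
  have h2 : 2 * Nr * (2 * (L : ℝ) ^ 2 - Nr + 2) * (4 * ε ^ 2 / γ ^ 2) ≤ α / 8 := by
    rw [show 2 * Nr * (2 * (L : ℝ) ^ 2 - Nr + 2) * (4 * ε ^ 2 / γ ^ 2) =
        (4 * (2 * Nr * (2 * (L : ℝ) ^ 2 - Nr + 2)) * ε ^ 2) / γ ^ 2 by ring, div_le_iff₀ hγ2]
    have hε2 : 0 ≤ ε ^ 2 := sq_nonneg ε
    linarith [mul_le_mul_of_nonneg_right hM8 hε2, hsmall]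
  have hquarter : α / 4 ≤
      (star ψ ⬝ᵥ ((pairField dWaveFormFactor L)ᴴ * pairField dWaveFormFactor L) *ᵥ ψ).re := by
    have hsplit : (α / 2 + 2 * Nr * (2 * (L : ℝ) ^ 2 - Nr + 2)) * (4 * ε ^ 2 / γ ^ 2) =
        α / 2 * (4 * ε ^ 2 / γ ^ 2) + 2 * Nr * (2 * (L : ℝ) ^ 2 - Nr + 2) * (4 * ε ^ 2 / γ ^ 2) := by
      ring
    rw [hsplit] at hmain
    linarith
  -- conclusion in the crux's normalisation
  have hL4 : (0 : ℝ) < (L : ℝ) ^ 4 := by positivity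
  rw [le_div_iff₀ hL4]
  simp only [expect]
  linarith

end Summit.HubbardSuperconductivity.HubbardSuperconductivity.Theorems.BcsKacWindow
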